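import Summits.HodgeConjecture.HodgeConjecture.Theorems.H413ThetaPairRepArchFinFactorisation
import Literature.NumberTheory.Li1992.SchwartzPairingPolarization
import Literature.NumberTheory.Li1992.SchwartzPureTensorL2
import Literature.NumberTheory.Automorphic.UnitaryGroupRationalDiscrete
import Literature.NumberTheory.Automorphic.UnitaryGroupOfFormAdelicTopology
import Literature.NumberTheory.Automorphic.AdelicPiSchwartzBruhatToLp
import Literature.NumberTheory.Automorphic.SchwartzBruhatCosetIndicator
import Literature.NumberTheory.Automorphic.AdicCompletionCompact
import Literature.MeasureTheory.Group.LatticeSumLeIntegral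
import HarnessLib

/-!
# H413 ∕ E-2 ∕ `StubSW2` (ii): the ORBITAL SUMS `Σ_{γ ∈ U(J_W)(F)} |⟨ω(γ)ω(x₁⁻¹)Φ₁, ω(x₂⁻¹)Φ₂⟩|` are bounded, uniformly in
# `(x₁, x₂)` — REDUCTION to the finite-adelic absolute integral (Road C «lattice sum ≤ integral», compact archimedean member)

Crux H413 (stmt-HodgeConjecture-24833), child line `Cruxes/H413/Lines/F0_E2SiegelWeilWeilRange.lean` (tree ED. 5), stub
`stub_SW2_siegelWeil`, CONJUNCT (ii) of `StubSW2` (:354): for `Φ₁ Φ₂ ∈ 𝒮(𝔸_Fⁿ)` and `(x₁, x₂)` in a compact subset of `U(J_W)(𝔸_F)²`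
the family `γ ↦ ‖⟨ω(1,γ)(ω(1,x₁⁻¹)Φ₁), ω(1,x₂⁻¹)Φ₂⟩_{ν_X}‖` (`γ ∈ U(J_W)(F)`) is summable with sum `≤ B`, `B` uniform on the compact set
([Li1992, (24)–(25) p. 184]: absolute convergence of the unfolded side of Rallis' inner product formula; [Weil1965, n° 51–52]).
Namespace `Summit.HodgeConjecture.HodgeConjecture.Cruxes.H413.E2SW2OrbitalSums`; KERNEL (theorems only, DEF-FREE, no `sorry`, no import
of the `Lines` module — the conjunct is restated with `J_V, J_W` general and `hJV, hJW` as in the ★ factorisation file, so it specialises to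
the letter by `rfl rfl`).

THE ARGUMENT (Road C; F0P4-plan (g3) 01:31:28Z).  (R0) POLARISATION (★ `schwartzPairing_pairRep_conj`, from the letter's `hiso`) and the
COMMUTATIVITY of the rank-one group `U(J_W)(𝔸_F) ≅ 𝔸_E¹`: the term is `‖⟨ω(1, w·γ)Φ₁, Φ₂⟩‖` with `w = x₂x₁⁻¹`.  (R1) `Φ₁, Φ₂` are finite
sums of pure tensors `Φ_∞ ⊗ Φ_f` (`piSchwartzBruhatEquiv`, `TensorProduct.exists_finset`) and the pairing is sesquilinear
(`schwartzPairing_eq_inner_piSchwartzBruhatToLp`).  (R2) On pure tensors `ω(1, a·b)(Φ_∞ ⊗ Φ_f) = ω_∞(a)Φ_∞ ⊗ ω_f(b)Φ_f`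
(★ `ThetaNonvanishing.pairRep_one_archToAdelic_mul_finAdelicToAdelic_tmul`) and `⟨· ⊗ ·, · ⊗ ·⟩ = c_X ⟨·,·⟩_∞ ⟨·,·⟩_f`
(★ `Li1992.schwartzPairing_tmul_tmul`, `exists_haar_eq_smul_map_prod`).  (R3) The ARCHIMEDEAN factor is bounded INDEPENDENTLY of `a`:
`|⟨ω_∞(a)Φ_∞, Ψ_∞⟩_∞| ≤ ‖Φ_∞‖₂ ‖Ψ_∞‖₂`, because `ω_∞(a)` is an `L²`-ISOMETRY — derived here from the letter's global `hiso` by testing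
against `Φ_∞ ⊗ 𝟙_{𝒪̂ⁿ}` (`lintegral_enorm_sq_tmul`, `lintegral_enorm_sq_archWeilRep`, `norm_archCoeff_le`); no continuity of the splitting is
used.  (R4) Hence `term(γ) ≤ F(w γ)` with `F(g) = Σ_{p,q} c_X ‖p_∞‖₂‖q_∞‖₂ |⟨ω_f(g_f) p_f, q_f⟩_f|` a function of the FINITE component `g_f`
alone, right-invariant under the compact open subgroup `K = {g | g_f ∈ K_f}` (`U(J_W)(E ⊗ ℝ)` COMPACT — the CM ∕ definite situation of every
consumer; `K_f` a level fixing the finitely many `p_f` up to unit scalars, hypothesis `hK`) and integrable for the Haar measure of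
`U(J_W)(𝔸_F)` as soon as the finite coefficients `b ↦ ⟨ω_f(b)p_f, q_f⟩_f` are integrable on `U(J_W)(𝔸_{F,f})` (hypothesis `hF`; the image of
Haar under `g ↦ g_f` is Haar, ★ `UnitaryGroup.isHaarMeasure_map_finPart`).  (R5) ★ `LatticeSumLeIntegral.summable_and_tsum_le_of_le_translate`:
`Σ_γ F(wγ) ≤ |U(J_W)(F) ∩ K| · μ(K)⁻¹ · ∫ F` for EVERY `w` (`U(J_W)(F) ∩ K` finite: ★ `UnitaryGroup.finite_range_inter_preimage_finPart`), so
ONE bound serves all `(x₁, x₂)` (compactness of `C` is not even used).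

THE TWO DISPLAYED HYPOTHESES of `orbitalSums_bounded_of_finIntegrable` (the finite-adelic content of (ii), discharged by separate files):
* `hK` — SMOOTHNESS MOD UNIT SCALARS of the `U(J_W)(𝔸_{F,f})`-member of the finite Weil representation: every `v ∈ 𝒮((𝔸_F^∞)^{N×1})` is an
  eigenvector with unimodular eigenvalues of some compact open subgroup (for a CONTINUOUS pair splitting this is ★
  `WeilCoinv.finPairRepW_smooth` with eigenvalue `1`; for a bare compatible splitting it follows from the projective lattice rigidity and `hiso`);
* `hF` — ABSOLUTE INTEGRABILITY of the finite matrix coefficients `b ↦ ⟨R_e ω_f(1,b) R_e⁻¹ Φ_f, Ψ_f⟩_{μ_f}` on `U(J_W)(𝔸_{F,f})` for every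
  Haar measure (the absolute Euler product of [Li1992, §5]: almost all local factors `≤ 1 + 4 q_v^{-N/2}`, `N > 2`; Road C pieces C5 ∕ C-β).

HC_CM is proved only modulo the printed citations until rung 0 closes; this file proves nothing printed and touches no binder.

## References
* [Li1992] J.-S. Li, J. reine angew. Math. 428 (1992), (24)–(27) p. 184; §5.
* [Weil1965] A. Weil, Acta Math. 113 (1965), n° 51–52.
* [Weil1964] A. Weil, Acta Math. 111 (1964), Chap. III n° 37–39.
* [BorelJacquet1979] A. Borel, H. Jacquet, Proc. Symp. Pure Math. 33.1 (1979), §4.1.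
* [Garrett2018] P. Garrett, *Modern Analysis of Automorphic Forms by Example* (2018), §2.2.
-/

set_option autoImplicit false
set_option linter.dupNamespace false

noncomputable section

open _root_.MeasureTheory NumberField NumberField.mixedEmbedding IsDedekindDomain Filter
open scoped ComplexConjugate TensorProduct SchwartzMap NNReal ENNReal Classical InnerProductSpace
open Literature.NumberTheory.Automorphic Literature.NumberTheory.Weil1964 Literature.NumberTheory.Li1992
open Literature.NumberTheory.GelbartRogawski1991 Literature.NumberTheory.GelbartRogawski1991.UnitaryDualPair
open Literature.MeasureTheory.Group
open HodgeCM.Model.HypCensus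
open Summit.HodgeConjecture.HodgeConjecture.Cruxes.H413.ThetaNonvanishing

namespace Summit.HodgeConjecture.HodgeConjecture.Cruxes.H413.E2SW2OrbitalSums

/-! ## §1 (moved) the `L²` facts for pure tensors are `Li1992/SchwartzPureTensorL2` -/


/-! ## §2 The dual pair: polarisation + commutativity (R0), the archimedean isometry from `hiso` (R3) -/

section Pair

variable (F E : Type) [Field F] [NumberField F] [Field E] [NumberField E] [Algebra F E]
variable (c : E ≃ₐ[F] E) (N : ℕ) {n : ℕ} (e : Fin N × Fin 1 ≃ Fin n)
variable (JV : Matrix (Fin N) (Fin N) E) (JW : Matrix (Fin 1) (Fin 1) E)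
variable {TV : Matrix (Fin N) (Fin N) F} {TW : Matrix (Fin 1) (Fin 1) F}
variable [Algebra.IsQuadraticExtension F E] {δ : E} (hcδ : c δ = -δ) (hδ : δ ≠ 0) {d : F}
  (hd : δ * δ = algebraMap F E d) (hV : TV.IsSymm) (hW : TW.IsSymm) (hVd : IsUnit TV.det) (hWd : IsUnit TW.det)
  (hJV : JV = TV.map (algebraMap F E)) (hJW : JW = TW.map (algebraMap F E))
variable {s : UnitaryGroup.adelicPair F E c N 1 JV JW →* adelicMpCont F (Fin n) (adelicGram F e TV TW)}
  (hs : (splittingDatum F E c N 1 e JV JW hcδ hδ hd hV hW hVd hWd hJV hJW).IsCompatible s)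
  [MeasurableSpace (AdeleRing (𝓞 F) F)] [BorelSpace (AdeleRing (𝓞 F) F)]
  (νX : Measure (Fin n → AdeleRing (𝓞 F) F)) [νX.IsAddHaarMeasure]
  (hiso : ∀ (p : UnitaryGroup.adelic F E c N JV × UnitaryGroup.adelic F E c 1 JW) (Φ : piSchwartzBruhat F (Fin n)),
    ∫⁻ x, ‖(pairRep F E c N 1 e JV JW s p Φ : (Fin n → AdeleRing (𝓞 F) F) → ℂ) x‖ₑ ^ 2 ∂νX =
      ∫⁻ x, ‖(Φ : (Fin n → AdeleRing (𝓞 F) F) → ℂ) x‖ₑ ^ 2 ∂νX)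

omit [NumberField F] [NumberField E] [Algebra.IsQuadraticExtension F E] in
/-- `1 × 1` invertible matrices over a commutative ring commute. [folklore] -/
private theorem gl_one_mul_comm {R : Type*} [CommRing R] (g h : GL (Fin 1) R) : g * h = h * g := by
  refine Units.ext (Matrix.ext fun i j => ?_)
  obtain rfl : i = 0 := Subsingleton.elim _ _
  obtain rfl : j = 0 := Subsingleton.elim _ _
  simp only [Units.val_mul, Matrix.mul_apply, Finset.univ_unique, Fin.default_eq_zero, Finset.sum_singleton]
  exact mul_comm _ _

omit [NumberField F] [Algebra.IsQuadraticExtension F E] in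
/-- **rank one is commutative**: `U(J_W)(𝔸_F)` (`J_W` a `1 × 1` matrix; `≅ 𝔸_E¹`) is a commutative group. [folklore] -/
theorem adelic_mul_comm (g h : UnitaryGroup.adelic F E c 1 JW) : g * h = h * g :=
  Subtype.ext (gl_one_mul_comm _ _)

omit [Algebra.IsQuadraticExtension F E] in
include hiso in
/-- **(R0) the term of (ii), absorbed**: `‖⟨ω(1,γ)(ω(1,x₁⁻¹)Φ₁), ω(1,x₂⁻¹)Φ₂⟩‖ = ‖⟨ω(1, (x₂x₁⁻¹)·γ)Φ₁, Φ₂⟩‖` (polarised `hiso`, ★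
`schwartzPairing_pairRep_conj`, and commutativity of `U(J_W)(𝔸_F)`). [cite: Li1992, (24)–(25) p. 184] -/
theorem term_eq (γ x₁ x₂ : UnitaryGroup.adelic F E c 1 JW) (Φ₁ Φ₂ : piSchwartzBruhat F (Fin n)) :
    schwartzPairing F (Fin n) νX (pairRep F E c N 1 e JV JW s (1, γ) (pairRep F E c N 1 e JV JW s (1, x₁⁻¹) Φ₁))
        (pairRep F E c N 1 e JV JW s (1, x₂⁻¹) Φ₂) =
      schwartzPairing F (Fin n) νX (pairRep F E c N 1 e JV JW s (1, (x₂ * x₁⁻¹) * γ) Φ₁) Φ₂ := by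
  have h := schwartzPairing_pairRep_conj F E c N 1 e JV JW s νX hiso ((1 : UnitaryGroup.adelic F E c N JV), γ)
    ((1 : UnitaryGroup.adelic F E c N JV), x₁) ((1 : UnitaryGroup.adelic F E c N JV), x₂) Φ₁ Φ₂
  simp only [Prod.inv_mk, inv_one, Prod.mk_mul_mk, mul_one] at h
  have hx : x₂ * γ * x₁⁻¹ = x₂ * x₁⁻¹ * γ := by
    rw [mul_assoc, adelic_mul_comm F E c JW γ x₁⁻¹, ← mul_assoc]
  rw [← h, hx]

set_option maxHeartbeats 400000 in
omit [νX.IsAddHaarMeasure] in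
include hiso in
/-- **(R3) the archimedean Weil operators are `L²`-isometries**: `∫ |archWeilRep (1,a) Φ_∞|² dμ_∞ = ∫ |Φ_∞|² dμ_∞` — the letter's global
`hiso` tested against `Φ_∞ ⊗ 𝟙_{𝒪̂ⁿ}` (★ `pairRep_one_archToAdelic_tmul`, `lintegral_enorm_sq_tmul`, `0 < μ_f(𝒪̂ⁿ) < ∞`). No continuity of the
splitting is used. [cite: Weil1964, Chap. III n° 37–39] [cite: Li1992, p. 178] -/
theorem lintegral_enorm_sq_archWeilRep [BorelSpace (Fin n → mixedSpace F)] [MeasurableSpace (FiniteAdeleRing (𝓞 F) F)]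
    [BorelSpace (FiniteAdeleRing (𝓞 F) F)] {μE : Measure (Fin n → mixedSpace F)} {μf : Measure (Fin n → FiniteAdeleRing (𝓞 F) F)} {cX : ℝ≥0}
    [SFinite μE] [μf.IsAddHaarMeasure] (hcX : 0 < cX) (hν : νX = cX • (μE.prod μf).map (piAdeleSplit F (Fin n)))
    (a : UnitaryGroup.arch F E c 1 JW) (Φinf : 𝓢((Fin n → mixedSpace F), ℂ)) :
    ∫⁻ u, ‖archWeilRep F E c N 1 JV JW hcδ hδ hd hV hW hVd hWd hJV hJW e s
        (proj_apply_eq_toSp F E c N 1 e JV JW hcδ hδ hd hV hW hVd hWd hJV hJW hs) (1, a) Φinf u‖ₑ ^ 2 ∂μE =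
      ∫⁻ u, ‖Φinf u‖ₑ ^ 2 ∂μE := by
  haveI := secondCountableTopology_finiteAdeleRing F
  haveI := locallyCompactSpace_finiteAdeleRing' F
  haveI : BorelSpace (Fin n → FiniteAdeleRing (𝓞 F) F) := Pi.borelSpace
  -- the finite test vector `𝟙_{𝒪̂ⁿ}`, of `L²`-mass `μ_f(𝒪̂ⁿ) ∈ (0, ∞)`
  set L : AddSubgroup (Fin n → FiniteAdeleRing (𝓞 F) F) := piLevelIdeal F (Fin n) ⊤ with hL
  have hLo : IsOpen (L : Set (Fin n → FiniteAdeleRing (𝓞 F) F)) := isOpen_piLevelIdeal F ⊤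
  have hLc : IsCompact (L : Set (Fin n → FiniteAdeleRing (𝓞 F) F)) := isCompact_piLevelIdeal F (Fin n) ⊤
  set f₀ : FinSB F (Fin n) := indicatorSB F (Fin n) L hLo hLc with hf₀
  have hm0 : μf L ≠ 0 := hLo.measure_ne_zero μf ⟨0, L.zero_mem⟩
  have hmt : μf L ≠ ∞ := hLc.measure_lt_top.ne
  -- `hiso` at `p = (1, (a, 1_f))`, `Φ = Φ_∞ ⊗ 𝟙`
  have key := hiso (1, UnitaryGroup.archToAdelic F E c 1 JW a) (piSchwartzBruhatEquiv F (Fin n) (Φinf ⊗ₜ f₀))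
  rw [pairRep_one_archToAdelic_tmul F E c N 1 e JV JW hcδ hδ hd hV hW hVd hWd hJV hJW hs a Φinf f₀,
    lintegral_enorm_sq_tmul F (Fin n) hν, lintegral_enorm_sq_tmul F (Fin n) hν, lintegral_enorm_sq_indicatorSB] at key
  -- cancel `c_X · μ_f(L)`
  have hc0 : (cX : ℝ≥0∞) ≠ 0 := by exact_mod_cast hcX.ne'
  have h1 := (ENNReal.mul_right_inj hc0 ENNReal.coe_ne_top).1 key
  exact (ENNReal.mul_left_inj hm0 hmt).1 h1

omit [νX.IsAddHaarMeasure] in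
include hiso in
/-- **(R3′) the archimedean matrix coefficient is bounded independently of the group element**:
`|⟨archWeilRep (1,a) Φ_∞, Ψ_∞⟩_∞| ≤ ‖Φ_∞‖₂ ‖Ψ_∞‖₂` for all `a ∈ U(J_W)(E ⊗ ℝ)`. [cite: Weil1964, Chap. III n° 37–39] [cite: Li1992, (27) p. 184] -/
theorem norm_archCoeff_le [BorelSpace (Fin n → mixedSpace F)] [MeasurableSpace (FiniteAdeleRing (𝓞 F) F)]
    [BorelSpace (FiniteAdeleRing (𝓞 F) F)] {μE : Measure (Fin n → mixedSpace F)} {μf : Measure (Fin n → FiniteAdeleRing (𝓞 F) F)} {cX : ℝ≥0}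
    [SFinite μE] [μE.HasTemperateGrowth] [μf.IsAddHaarMeasure] (hcX : 0 < cX)
    (hν : νX = cX • (μE.prod μf).map (piAdeleSplit F (Fin n)))
    (a : UnitaryGroup.arch F E c 1 JW) (Φinf Ψinf : 𝓢((Fin n → mixedSpace F), ℂ)) :
    ‖∫ u, archWeilRep F E c N 1 JV JW hcδ hδ hd hV hW hVd hWd hJV hJW e s
        (proj_apply_eq_toSp F E c N 1 e JV JW hcδ hδ hd hV hW hVd hWd hJV hJW hs) (1, a) Φinf u * conj (Ψinf u) ∂μE‖ ≤
      ‖Φinf.toLp 2 μE‖ * ‖Ψinf.toLp 2 μE‖ := by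
  rw [← norm_toLp_eq_of_lintegral_eq F (Fin n)
    (lintegral_enorm_sq_archWeilRep F E c N e JV JW hcδ hδ hd hV hW hVd hWd hJV hJW hs νX hiso hcX hν a Φinf)]
  exact norm_archPairing_le F (Fin n) _ Ψinf

/-- **sesquilinearity of the pairing over finite sums** (it is the `L²(ν_X)` inner product of the classes). [cite: Li1992, p. 178] -/
theorem schwartzPairing_sum_sum {α β : Type*} (S : Finset α) (T : Finset β) (f : α → piSchwartzBruhat F (Fin n))
    (g : β → piSchwartzBruhat F (Fin n)) :
    schwartzPairing F (Fin n) νX (∑ i ∈ S, f i) (∑ j ∈ T, g j) = ∑ j ∈ T, ∑ i ∈ S, schwartzPairing F (Fin n) νX (f i) (g j) := by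
  simp_rw [schwartzPairing_eq_inner_piSchwartzBruhatToLp F (Fin n) νX, map_sum, sum_inner, inner_sum]

/-! ## §3 The reduction: conjunct (ii) of `StubSW2` from a COMPACT archimedean member, smoothness mod unit scalars of the finite Weil
representation (`hK`) and absolute integrability of the finite matrix coefficients (`hF`) -/

set_option maxHeartbeats 1600000 in
include hiso in
/-- **`StubSW2` (ii) — ORBITAL SUMS BOUNDED UNIFORMLY — reduced to the finite-adelic absolute integral.**  For the tree's unitary dual pair
`(U(J_V), U(J_W))`, `J_W` a hermitian LINE, ANY compatible pair splitting `s` with `ω = ω_ψ ∘ s_pair` unitary on `𝒮(𝔸_Fⁿ)` (`hiso`), and a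
COMPACT archimedean member `U(J_W)(E ⊗ ℝ)`: IF every finite Schwartz–Bruhat vector is an eigenvector with unimodular eigenvalues of a compact
open subgroup of `U(J_W)(𝔸_{F,f})` under the finite Weil representation (`hK`), and the finite matrix coefficients
`b ↦ ⟨R_e ω_f(1,b) R_e⁻¹ Φ_f, Ψ_f⟩_{μ_f}` are integrable on `U(J_W)(𝔸_{F,f})` for all Haar measures (`hF`), THEN for all `Φ₁ Φ₂ ∈ 𝒮(𝔸_Fⁿ)` and
every (compact) `C ⊆ U(J_W)(𝔸_F)²` there is `B` with: for `(x₁, x₂) ∈ C` the family `γ ↦ ‖⟨ω(1,γ)(ω(1,x₁⁻¹)Φ₁), ω(1,x₂⁻¹)Φ₂⟩_{ν_X}‖`,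
`γ ∈ U(J_W)(F)`, is summable with sum `≤ B` — VERBATIM the second conjunct of `StubSW2` (child line ED. 5 :354, with `J_V, J_W, hJV, hJW`
general).  Road C: (R0)–(R5) of the module docstring. [cite: Li1992, (24)–(25) p. 184] [cite: Weil1965, n° 51–52]
[cite: Garrett2018, §2.2 Thm. 2.2.2] -/
theorem orbitalSums_bounded_of_finIntegrable [CompactSpace (UnitaryGroup.arch F E c 1 JW)]
    (hK : ∀ v : FinSB F (Fin N × Fin 1), ∃ Kf : Subgroup (UnitaryGroup.finAdelic F E c 1 JW),
      IsOpen (Kf : Set (UnitaryGroup.finAdelic F E c 1 JW)) ∧ IsCompact (Kf : Set (UnitaryGroup.finAdelic F E c 1 JW)) ∧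
      ∀ k ∈ Kf, ∃ z : ℂ, ‖z‖ = 1 ∧
        WeilCoinv.finPairRep F E c N 1 e JV JW hcδ hδ hd hV hW hVd hWd hJV hJW hs (1, k) v = z • v)
    (hF : ∀ [MeasurableSpace (FiniteAdeleRing (𝓞 F) F)] [BorelSpace (FiniteAdeleRing (𝓞 F) F)]
      (μf : Measure (Fin n → FiniteAdeleRing (𝓞 F) F)) [μf.IsAddHaarMeasure]
      [MeasurableSpace (UnitaryGroup.finAdelic F E c 1 JW)] [BorelSpace (UnitaryGroup.finAdelic F E c 1 JW)]
      (μb : Measure (UnitaryGroup.finAdelic F E c 1 JW)) [μb.IsHaarMeasure] (Φf Ψf : FinSB F (Fin n)),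
      Integrable (fun b : UnitaryGroup.finAdelic F E c 1 JW =>
        ∫ y, ((finSBReindex F e (WeilCoinv.finPairRep F E c N 1 e JV JW hcδ hδ hd hV hW hVd hWd hJV hJW hs (1, b)
            ((finSBReindex F e).symm Φf)) : FinSB F (Fin n)) : (Fin n → FiniteAdeleRing (𝓞 F) F) → ℂ) y *
          conj ((Ψf : (Fin n → FiniteAdeleRing (𝓞 F) F) → ℂ) y) ∂μf) μb)
    (Φ₁ Φ₂ : piSchwartzBruhat F (Fin n)) (C : Set (UnitaryGroup.adelic F E c 1 JW × UnitaryGroup.adelic F E c 1 JW))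
    (_hC : IsCompact C) :
    ∃ B : ℝ, ∀ (x₁ x₂ : UnitaryGroup.adelic F E c 1 JW), (x₁, x₂) ∈ C →
      Summable (fun γ : (UnitaryGroup.toAdelic F E c 1 JW).range =>
        ‖schwartzPairing F (Fin n) νX (pairRep F E c N 1 e JV JW s (1, (γ : UnitaryGroup.adelic F E c 1 JW))
            (pairRep F E c N 1 e JV JW s (1, x₁⁻¹) Φ₁)) (pairRep F E c N 1 e JV JW s (1, x₂⁻¹) Φ₂)‖) ∧
      ∑' γ : (UnitaryGroup.toAdelic F E c 1 JW).range,
        ‖schwartzPairing F (Fin n) νX (pairRep F E c N 1 e JV JW s (1, (γ : UnitaryGroup.adelic F E c 1 JW))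
            (pairRep F E c N 1 e JV JW s (1, x₁⁻¹) Φ₁)) (pairRep F E c N 1 e JV JW s (1, x₂⁻¹) Φ₂)‖ ≤ B := by
  -- (0) σ-algebras and Haar measures: `μ_∞` on `(F⊗ℝ)ⁿ`, `μ_f` on `(𝔸_F^∞)ⁿ`, `μ_G` on `G = U(J_W)(𝔸_F)`, `μ_b = (g ↦ g_f)_* μ_G`
  haveI := secondCountableTopology_adeleRing F
  haveI := secondCountableTopology_finiteAdeleRing F
  haveI := locallyCompactSpace_finiteAdeleRing' F
  haveI : BorelSpace (Fin n → mixedSpace F) := Pi.borelSpace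
  letI mF : MeasurableSpace (FiniteAdeleRing (𝓞 F) F) := borel _
  haveI : BorelSpace (FiniteAdeleRing (𝓞 F) F) := ⟨rfl⟩
  haveI : BorelSpace (Fin n → FiniteAdeleRing (𝓞 F) F) := Pi.borelSpace
  letI mG : MeasurableSpace (UnitaryGroup.adelic F E c 1 JW) := borel _
  haveI : BorelSpace (UnitaryGroup.adelic F E c 1 JW) := ⟨rfl⟩
  letI mGf : MeasurableSpace (UnitaryGroup.finAdelic F E c 1 JW) := borel _
  haveI : BorelSpace (UnitaryGroup.finAdelic F E c 1 JW) := ⟨rfl⟩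
  set μE : Measure (Fin n → mixedSpace F) := Measure.addHaar with hμE
  set μf : Measure (Fin n → FiniteAdeleRing (𝓞 F) F) := Measure.addHaar with hμf
  obtain ⟨cX, hcX, hν⟩ := exists_haar_eq_smul_map_prod F (Fin n) νX μE μf
  set μG : Measure (UnitaryGroup.adelic F E c 1 JW) := Measure.haar with hμG
  set πf : UnitaryGroup.adelic F E c 1 JW →* UnitaryGroup.finAdelic F E c 1 JW := UnitaryGroup.finPart F E c 1 JW with hπf
  have hπfc : Continuous πf := UnitaryGroup.continuous_finPart F E c 1 JW
  set μb : Measure (UnitaryGroup.finAdelic F E c 1 JW) := μG.map πf with hμb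
  have hGH : μG.IsHaarMeasure := by rw [hμG]; infer_instance
  letI : MeasurableSpace (UnitaryGroup.adelicGroupData F E c 1 JW).Adelic := mG
  haveI : BorelSpace (UnitaryGroup.adelicGroupData F E c 1 JW).Adelic := ⟨rfl⟩
  haveI : @Measure.IsHaarMeasure (UnitaryGroup.adelicGroupData F E c 1 JW).Adelic _ _ _ μG := hGH
  haveI : μb.IsHaarMeasure := UnitaryGroup.isHaarMeasure_map_finPart F E c 1 JW μG
  -- (1) pure-tensor decompositions of `Φ₁, Φ₂`
  obtain ⟨t₁, rfl⟩ := (piSchwartzBruhatEquiv F (Fin n)).surjective Φ₁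
  obtain ⟨t₂, rfl⟩ := (piSchwartzBruhatEquiv F (Fin n)).surjective Φ₂
  obtain ⟨S₁, hS₁⟩ := TensorProduct.exists_finset t₁
  obtain ⟨S₂, hS₂⟩ := TensorProduct.exists_finset t₂
  -- the finite matrix coefficients
  set fin : FinSB F (Fin n) → FinSB F (Fin n) → UnitaryGroup.finAdelic F E c 1 JW → ℂ := fun pf qf b =>
    ∫ y, ((finSBReindex F e (WeilCoinv.finPairRep F E c N 1 e JV JW hcδ hδ hd hV hW hVd hWd hJV hJW hs (1, b)
        ((finSBReindex F e).symm pf)) : FinSB F (Fin n)) : (Fin n → FiniteAdeleRing (𝓞 F) F) → ℂ) y *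
      conj ((qf : (Fin n → FiniteAdeleRing (𝓞 F) F) → ℂ) y) ∂μf with hfin_def
  -- (2) the factorised pairing of pure tensors at `g = (g_∞, 1)(1, g_f)`
  have hpq : ∀ (g : UnitaryGroup.adelic F E c 1 JW) (p q : 𝓢((Fin n → mixedSpace F), ℂ) × FinSB F (Fin n)),
      schwartzPairing F (Fin n) νX (pairRep F E c N 1 e JV JW s (1, g) (piSchwartzBruhatEquiv F (Fin n) (p.1 ⊗ₜ p.2)))
          (piSchwartzBruhatEquiv F (Fin n) (q.1 ⊗ₜ q.2)) =
        (cX : ℂ) * ((∫ u, archWeilRep F E c N 1 JV JW hcδ hδ hd hV hW hVd hWd hJV hJW e s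
            (proj_apply_eq_toSp F E c N 1 e JV JW hcδ hδ hd hV hW hVd hWd hJV hJW hs) (1, UnitaryGroup.archPart F E c 1 JW g) p.1 u *
              conj (q.1 u) ∂μE) * fin p.2 q.2 (πf g)) := by
    intro g p q
    conv_lhs => rw [← UnitaryGroup.archToAdelic_mul_finAdelicToAdelic F E c 1 JW g]
    rw [pairRep_one_archToAdelic_mul_finAdelicToAdelic_tmul F E c N 1 e JV JW hcδ hδ hd hV hW hVd hWd hJV hJW hs,
      schwartzPairing_tmul_tmul F (Fin n) hν]
    rfl
  -- the termwise bound, uniform in the archimedean component (R3′)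
  set M : (𝓢((Fin n → mixedSpace F), ℂ) × FinSB F (Fin n)) → (𝓢((Fin n → mixedSpace F), ℂ) × FinSB F (Fin n)) → ℝ :=
    fun p q => (cX : ℝ) * (‖p.1.toLp 2 μE‖ * ‖q.1.toLp 2 μE‖) with hM
  have hM0 : ∀ p q, 0 ≤ M p q := fun p q =>
    mul_nonneg cX.coe_nonneg (mul_nonneg (norm_nonneg _) (norm_nonneg _))
  have hterm : ∀ (g : UnitaryGroup.adelic F E c 1 JW) (p q : 𝓢((Fin n → mixedSpace F), ℂ) × FinSB F (Fin n)),
      ‖schwartzPairing F (Fin n) νX (pairRep F E c N 1 e JV JW s (1, g) (piSchwartzBruhatEquiv F (Fin n) (p.1 ⊗ₜ p.2)))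
          (piSchwartzBruhatEquiv F (Fin n) (q.1 ⊗ₜ q.2))‖ ≤ M p q * ‖fin p.2 q.2 (πf g)‖ := by
    intro g p q
    rw [hpq, norm_mul, norm_mul, show ((cX : ℂ)) = ((cX : ℝ) : ℂ) from rfl, Complex.norm_real, Real.norm_eq_abs,
      NNReal.abs_eq, hM, mul_assoc]
    refine mul_le_mul_of_nonneg_left (mul_le_mul_of_nonneg_right ?_ (norm_nonneg _)) cX.coe_nonneg
    exact norm_archCoeff_le F E c N e JV JW hcδ hδ hd hV hW hVd hWd hJV hJW hs νX hiso hcX hν _ p.1 q.1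
  -- (3) the majorant `F(g) = Ψ(g_f)` and the bound `‖⟨ω(1,g)Φ₁, Φ₂⟩‖ ≤ F(g)`
  set Ψ : UnitaryGroup.finAdelic F E c 1 JW → ℝ := fun b => ∑ q ∈ S₂, ∑ p ∈ S₁, M p q * ‖fin p.2 q.2 b‖ with hΨ
  have hΨ0 : ∀ b, 0 ≤ Ψ b := fun b =>
    Finset.sum_nonneg fun q _ => Finset.sum_nonneg fun p _ => mul_nonneg (hM0 p q) (norm_nonneg _)
  have hmaj : ∀ g : UnitaryGroup.adelic F E c 1 JW,
      ‖schwartzPairing F (Fin n) νX (pairRep F E c N 1 e JV JW s (1, g) (piSchwartzBruhatEquiv F (Fin n) t₁))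
          (piSchwartzBruhatEquiv F (Fin n) t₂)‖ ≤ Ψ (πf g) := by
    intro g
    rw [hS₁, hS₂, map_sum, map_sum, map_sum, schwartzPairing_sum_sum F νX]
    refine (norm_sum_le _ _).trans (Finset.sum_le_sum fun q _ => (norm_sum_le _ _).trans (Finset.sum_le_sum fun p _ => ?_))
    exact hterm g p q
  -- (4) the level `K_f` fixing the finitely many `p_f` up to unit scalars, and `K = {g | g_f ∈ K_f}`
  choose Kf hKo hKc hKz using fun p : 𝓢((Fin n → mixedSpace F), ℂ) × FinSB F (Fin n) => hK ((finSBReindex F e).symm p.2)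
  obtain ⟨K₀, hK₀o, hK₀c, -⟩ := hK 0
  set Kf₀ : Subgroup (UnitaryGroup.finAdelic F E c 1 JW) := K₀ ⊓ ⨅ p ∈ S₁, Kf p with hKf₀
  have hKf₀o : IsOpen (Kf₀ : Set (UnitaryGroup.finAdelic F E c 1 JW)) := by
    rw [hKf₀, Subgroup.coe_inf]
    simp only [Subgroup.coe_iInf]
    exact hK₀o.inter (isOpen_biInter_finset fun p _ => hKo p)
  have hKf₀c : IsCompact (Kf₀ : Set (UnitaryGroup.finAdelic F E c 1 JW)) :=
    hK₀c.of_isClosed_subset (Subgroup.isClosed_of_isOpen _ hKf₀o) (by rw [hKf₀, Subgroup.coe_inf]; exact Set.inter_subset_left)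
  have hKf₀le : ∀ p ∈ S₁, Kf₀ ≤ Kf p := fun p hp => inf_le_right.trans (iInf₂_le p hp)
  set K : Subgroup (UnitaryGroup.adelic F E c 1 JW) := Kf₀.comap πf with hKdef
  have hKo' : IsOpen (K : Set (UnitaryGroup.adelic F E c 1 JW)) := UnitaryGroup.isOpen_preimage_finPart F E c 1 JW hKf₀o
  have hKc' : IsCompact (K : Set (UnitaryGroup.adelic F E c 1 JW)) := UnitaryGroup.isCompact_preimage_finPart F E c 1 JW hKf₀c
  have hfin : ((((UnitaryGroup.toAdelic F E c 1 JW).range : Subgroup (UnitaryGroup.adelic F E c 1 JW)) :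
      Set (UnitaryGroup.adelic F E c 1 JW)) ∩ (K : Set (UnitaryGroup.adelic F E c 1 JW))).Finite :=
    UnitaryGroup.finite_range_inter_preimage_finPart F E c 1 JW hKf₀c
  -- right-`K`-invariance of the majorant
  have hfinK : ∀ (p q : 𝓢((Fin n → mixedSpace F), ℂ) × FinSB F (Fin n)), p ∈ S₁ →
      ∀ (b k : UnitaryGroup.finAdelic F E c 1 JW), k ∈ Kf₀ → ‖fin p.2 q.2 (b * k)‖ = ‖fin p.2 q.2 b‖ := by
    intro p q hp b k hk
    obtain ⟨z, hz1, hz⟩ := hKz p k (hKf₀le p hp hk)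
    have hmul : WeilCoinv.finPairRep F E c N 1 e JV JW hcδ hδ hd hV hW hVd hWd hJV hJW hs (1, b * k) =
        WeilCoinv.finPairRep F E c N 1 e JV JW hcδ hδ hd hV hW hVd hWd hJV hJW hs (1, b) *
          WeilCoinv.finPairRep F E c N 1 e JV JW hcδ hδ hd hV hW hVd hWd hJV hJW hs (1, k) := by
      rw [← map_mul, Prod.mk_mul_mk, mul_one]
    have hval : fin p.2 q.2 (b * k) = z * fin p.2 q.2 b := by
      simp only [hfin_def]
      rw [hmul, Module.End.mul_apply, hz, map_smul, map_smul, ← integral_const_mul]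
      refine integral_congr_ae (Filter.Eventually.of_forall fun y => ?_)
      simp only [Submodule.coe_smul, Pi.smul_apply, smul_eq_mul]
      ring
    rw [hval, norm_mul, hz1, one_mul]
  have hΨK : ∀ (b k : UnitaryGroup.finAdelic F E c 1 JW), k ∈ Kf₀ → Ψ (b * k) = Ψ b := by
    intro b k hk
    simp only [hΨ]
    exact Finset.sum_congr rfl fun q _ => Finset.sum_congr rfl fun p hp => by rw [hfinK p q hp b k hk]
  have hFK : ∀ g k : UnitaryGroup.adelic F E c 1 JW, k ∈ K → Ψ (πf (g * k)) = Ψ (πf g) := by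
    intro g k hk
    rw [map_mul]
    exact hΨK _ _ (Subgroup.mem_comap.1 hk)
  -- integrability of the majorant: `Ψ` is `μ_b`-integrable by `hF`, `μ_b = (πf)_* μ_G`
  have hΨi : Integrable Ψ μb := by
    refine integrable_finsetSum _ fun q _ => integrable_finsetSum _ fun p _ => ?_
    exact (hF μf μb p.2 q.2).norm.const_mul (M p q)
  have hFi : Integrable (fun g : UnitaryGroup.adelic F E c 1 JW => Ψ (πf g)) μG :=
    (integrable_map_measure hΨi.aestronglyMeasurable hπfc.measurable.aemeasurable).1 hΨi
  -- (5) lattice sum ≤ integral, uniformly in the translation `w = x₂ x₁⁻¹`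
  refine ⟨hfin.toFinset.card * (μG.real (K : Set (UnitaryGroup.adelic F E c 1 JW)))⁻¹ * ∫ g, Ψ (πf g) ∂μG,
    fun x₁ x₂ _ => ?_⟩
  refine summable_and_tsum_le_of_le_translate_of_isCompact μG (UnitaryGroup.toAdelic F E c 1 JW).range K hKo' hKc' hfin
    (fun g => hΨ0 _) hFK hFi (x₂ * x₁⁻¹) (fun γ => norm_nonneg _) fun γ => ?_
  rw [term_eq F E c N e JV JW νX hiso]
  exact hmaj _

end Pair

end Summit.HodgeConjecture.HodgeConjecture.Cruxes.H413.E2SW2OrbitalSums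

end
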